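import Summits.QuantumFields.YangMills.Theorems.BalabanUVNodesN13UVChiOffSolvableAtRecord13

/-!
# BalabanUVNodes ∕ N13 — THE (UV₁₃) ROW `hUV` OF THE K1⁷ ENGINES = «UPPER HALF EVERYWHERE» + «LOWER HALF ON THE SMALL LOCUS»: the engines' binder, verbatim,
# from two strictly smaller displayed families (the large-field part of the lower half is p593634's sign bookkeeping)

Cell `pub-ymgap` (HUMAN RULING D-0062 Track A; D-0149 width seat `pub-ymgap-dag-n13-w1`, g2, INTENT-3), key K1⁷ `StabilityBAtRecordR13SepCoPH` = stmt-QuantumFields-20542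
(`--kind proof --supports … --as helper`).  [III] = [Balaban1988Convergent], [B16] = [Balaban1989LargeFieldII], [Av] = [Balaban1985Averaging].

WHY.  dag-n12-d's `…N12AtRecord13SepCoPHSockets.nodes₁₃CoPH_upS_fourPinW₀_pointed` ∕ dag-n24-c's four-pin family ∕ its K1⁷ closing shape `…N24K1ConsequentOfStubsAndChildren`'s
`hchildren` display N13's (UV₁₃) row as ONE binder
`hUV : ∀ P, InInterval w.γ P.K → ∀ k ≤ P.K, SLaw₁₃CoPH θ P k → ∀ U, χβ_k(U)·exp(−(1∕g_k²·A^η_k(U)) − w.em(g_k)|T₁^{(k)}|) ≤ ρ_k(U) ∧ ρ_k(U) ≤ exp(w.ep(g_k)|T₁^{(k)}|)`.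
p593634 showed the LOWER conjunct is sign bookkeeping at every `U` with a `b₀`-free plaquette deviating by `≥ 2εreg + 4ε₂₉` (the (2.9) species vanishes there on BOTH branches of
def-B's level-`(k+1)` map; `ρ_k ≥ 0`).  THIS FILE states the row's supplier shape ONCE, in kernel form: `hUV` VERBATIM (at `θ.toStage13Params` of a v1.7 parameter under its CORE
provisos, as the engines key it) from (U) the UPPER half everywhere and (Lˢ) the LOWER half on the SMALL LOCUS `{U : every b₀-free plaquette (2εreg + 4ε₂₉)-small}` only — both
guarded exactly like `hUV` (window + `SLaw₁₃CoPH`); numeric side conditions: `0 < εreg` in [Av] Prop. 2's range (`143·256·εreg ≤ ⅓`, `εreg ≤ δ_N∕(8L)²`).  So «WHICH PART OF N13's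
(UV₁₃) ROW IS CONTENT»: (U) = [III] Cor. 3's upper half ([B16] (1.73) ∕ (1.79) ∕ (1.89) summed — dag-n13-w3's leaves U1∕U2), (Lˢ) = the all-small term's lower bound ON SMALL FIELDS
([III] Thm 2 (2.49) at the record — the n11 ∕ n13-w3 Cor-3 edge); nothing of either is claimed here.

WHAT THIS FILE PROVES (2 theorems, 0 `def`): `hUV₁₃_of_upper_of_lowerSmallLocus` (engines' keying: `θ : Stage13HParams`, `h : θ.Provisos₁₃CoPH`); `uv₁₃_of_upper_of_lowerSmallLocus`
(unguarded `Stage13Params` form under the two ζ-laws).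

HONEST FRAMING.  Count-neutral by-name composition over p593634 (`uvLower_of_smallLocus`); nothing of Bałaban's asserted; (U) and (Lˢ) DISPLAYED; N13 NOT discharged; K0⁷∕K1⁷ NOT
closed; counts unmoved (5∕27 · A 5∕28); one finite `𝕋⁴_{L^K}` programme at fixed `ε = L^{−K}` — R4 closes the conditional finite-𝕋⁴ rung `BalabanLadder.UV` only; the YM mass gap
(Clay) is NOT proved by any of this.  No `def`, no `sorry`, no `instance`.
-/

noncomputable section

open scoped Matrix.Norms.L2Operator

namespace Summit.QuantumFields.YangMills.BalabanUVNodes.N13UVRowOfUpperAndSmallLocus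

open Literature.MathematicalPhysics.QuantumFieldTheory.Balaban1983to89
open Literature.MathematicalPhysics.QuantumFieldTheory.Balaban1983to89.T4Continuum (T4Family)
open Literature.MathematicalPhysics.QuantumFieldTheory.Balaban1983to89.Node00
open FlowStepRuns (genFlow)
open DagBinding (WorldP)
open ExpMeanLog (deltaSU)
open Summit.QuantumFields.YangMills.BalabanUVNodes.N13UVChiOffSolvableAtRecord13 (uvLower_of_smallLocus)

variable {F : T4Family} {N : ℕ} [NeZero N]

/-- `k ≤ P.K ⇒ k ≤ m + K` on the `P.K`-th torus (`(F.P K).K = K`, `(F.P K).m = m`). [cite: Balaban1987RG1, (0.1) p.251 (bookkeeping)] -/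
theorem le_m_add_K_of_le {P : B12.RunParams} {k : ℕ} (hk : k ≤ P.K) : k ≤ (F.P P.K).m + (F.P P.K).K := by
  rw [T4Family.P_K, T4Family.P_m]; omega

/-- **THE (UV₁₃) ROW AT A `Stage13Params`, UNGUARDED, FROM (U) + (Lˢ)** under the two ζ-laws and `εreg` in [Av] Prop. 2's range: for every run, level `k ≤ P.K`, dependence values
`em, ep`, the two-sided bound at EVERY `U` from the upper half at every `U` and the lower half on the small locus. [cite: Balaban1989LargeFieldII, (0.1) pp.355–356; Balaban1988Convergent, (2.50) p.264; Balaban1985Averaging, Prop. 2 (54) p.26] -/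
theorem uv₁₃_of_upper_of_lowerSmallLocus (θ : Stage13Params F N) (hζu : IsZetaUnity F N θ.ν θ.τ9.M θ.ζ) (hζa : IsZetaAbsLeOne F N θ.ν θ.τ9.M θ.ζ)
    (hε : 0 < θ.ν.εreg) (hε3 : (143 * ((((4 + 4 : ℕ) : ℝ)) ^ 2 / 4) ^ 2) * θ.ν.εreg ≤ 1 / 3)
    (hε2 : 2 * θ.ν.εreg ≤ 2 * deltaSU (Fin N) / ((((4 + 4) * F.L : ℕ) : ℝ) ^ 2))
    (P : B12.RunParams) {k : ℕ} (hk : k ≤ P.K) (em ep : ℝ)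
    (hupper : ∀ U : GaugeField (F.P P.K) k (SU N),
      densOfRecord₁₃ F N θ P k U ≤ Real.exp (ep * (Fintype.card (Site (F.P P.K) k) : ℝ)))
    (hlowerSmall : ∀ U : GaugeField (F.P P.K) k (SU N),
      (∀ p : Plaq (F.P P.K) k, ¬ IsB0 (F := F) (⟨p.src, p.μ⟩ : PBond (F.P P.K) k) → ¬ IsB0 (F := F) (⟨p.src.shift p.μ, p.ν⟩ : PBond (F.P P.K) k) →
        ¬ IsB0 (F := F) (⟨p.src.shift p.ν, p.μ⟩ : PBond (F.P P.K) k) → ¬ IsB0 (F := F) (⟨p.src, p.ν⟩ : PBond (F.P P.K) k) →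
        dist1 (GaugeField.plaqHol U p) < 2 * θ.ν.εreg + 4 * θ.ε₂₉) →
      chiβOfRecord₁₃ F N θ P.K (gOfRecord₁₃ F N θ P) k U *
          Real.exp (-(1 / (gOfRecord₁₃ F N θ P k) ^ 2 * wilsonBGOfRecord F N θ.εbg P k U) - em * (Fintype.card (Site (F.P P.K) k) : ℝ)) ≤
        densOfRecord₁₃ F N θ P k U)
    (U : GaugeField (F.P P.K) k (SU N)) :
    chiβOfRecord₁₃ F N θ P.K (gOfRecord₁₃ F N θ P) k U *
          Real.exp (-(1 / (gOfRecord₁₃ F N θ P k) ^ 2 * wilsonBGOfRecord F N θ.εbg P k U) - em * (Fintype.card (Site (F.P P.K) k) : ℝ)) ≤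
        densOfRecord₁₃ F N θ P k U ∧
      densOfRecord₁₃ F N θ P k U ≤ Real.exp (ep * (Fintype.card (Site (F.P P.K) k) : ℝ)) :=
  ⟨uvLower_of_smallLocus θ hζu hζa hε P (le_m_add_K_of_le hk) hε3 hε2 em hlowerSmall U, hupper U⟩

/-- **★ THE ENGINES' `hUV` BINDER, VERBATIM, FROM (U) «UPPER HALF EVERYWHERE» + (Lˢ) «LOWER HALF ON THE SMALL LOCUS»** — at `θ.toStage13Params` of a v1.7 parameter under its CORE
provisos `Provisos₁₃CoPH` (rows `zetaUnity` ∕ `zetaAbs` give `ζ ≥ 0`, dag-n21-d), both families guarded by the window and `SLaw₁₃CoPH` exactly as `hUV` is; `εreg` in [Av] Prop. 2's range.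
The conclusion is the `hUV` hypothesis of dag-n12-d's `nodes₁₃CoPH_upS_fourPinW₀_pointed` ∕ dag-n24-c's four-pin family LETTER FOR LETTER. [cite: Balaban1989LargeFieldII, Thm 1 p.355, (0.1) pp.355–356; Balaban1988Convergent, Cor. 3 (2.50) p.264; Balaban1987RG1, (2.9) p.266; Balaban1985Averaging, Prop. 2 (54) p.26] -/
theorem hUV₁₃_of_upper_of_lowerSmallLocus (θ : Stage13HParams F N) (h : θ.Provisos₁₃CoPH F N) (w : WorldP)
    (hε : 0 < θ.ν.εreg) (hε3 : (143 * ((((4 + 4 : ℕ) : ℝ)) ^ 2 / 4) ^ 2) * θ.ν.εreg ≤ 1 / 3)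
    (hε2 : 2 * θ.ν.εreg ≤ 2 * deltaSU (Fin N) / ((((4 + 4) * F.L : ℕ) : ℝ) ^ 2))
    (hupper : ∀ P : B12.RunParams, (genFlow (betaOfRecord₁₃ F N θ.toStage13Params) P.g0).InInterval w.γ P.K → ∀ k, k ≤ P.K → SLaw₁₃CoPH F N θ P k →
      ∀ U : GaugeField (F.P P.K) k (SU N),
        densOfRecord₁₃ F N θ.toStage13Params P k U ≤ Real.exp (w.ep (gOfRecord₁₃ F N θ.toStage13Params P k) * (Fintype.card (Site (F.P P.K) k) : ℝ)))
    (hlowerSmall : ∀ P : B12.RunParams, (genFlow (betaOfRecord₁₃ F N θ.toStage13Params) P.g0).InInterval w.γ P.K → ∀ k, k ≤ P.K → SLaw₁₃CoPH F N θ P k →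
      ∀ U : GaugeField (F.P P.K) k (SU N),
        (∀ p : Plaq (F.P P.K) k, ¬ IsB0 (F := F) (⟨p.src, p.μ⟩ : PBond (F.P P.K) k) → ¬ IsB0 (F := F) (⟨p.src.shift p.μ, p.ν⟩ : PBond (F.P P.K) k) →
          ¬ IsB0 (F := F) (⟨p.src.shift p.ν, p.μ⟩ : PBond (F.P P.K) k) → ¬ IsB0 (F := F) (⟨p.src, p.ν⟩ : PBond (F.P P.K) k) →
          dist1 (GaugeField.plaqHol U p) < 2 * θ.ν.εreg + 4 * θ.ε₂₉) →
        chiβOfRecord₁₃ F N θ.toStage13Params P.K (gOfRecord₁₃ F N θ.toStage13Params P) k U *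
            Real.exp (-(1 / (gOfRecord₁₃ F N θ.toStage13Params P k) ^ 2 * wilsonBGOfRecord F N θ.εbg P k U)
              - w.em (gOfRecord₁₃ F N θ.toStage13Params P k) * (Fintype.card (Site (F.P P.K) k) : ℝ)) ≤ densOfRecord₁₃ F N θ.toStage13Params P k U) :
    ∀ P : B12.RunParams, (genFlow (betaOfRecord₁₃ F N θ.toStage13Params) P.g0).InInterval w.γ P.K → ∀ k, k ≤ P.K → SLaw₁₃CoPH F N θ P k →
      ∀ U : GaugeField (F.P P.K) k (SU N),
        chiβOfRecord₁₃ F N θ.toStage13Params P.K (gOfRecord₁₃ F N θ.toStage13Params P) k U *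
              Real.exp (-(1 / (gOfRecord₁₃ F N θ.toStage13Params P k) ^ 2 * wilsonBGOfRecord F N θ.toStage13Params.εbg P k U)
                - w.em (gOfRecord₁₃ F N θ.toStage13Params P k) * (Fintype.card (Site (F.P P.K) k) : ℝ)) ≤ densOfRecord₁₃ F N θ.toStage13Params P k U ∧
        densOfRecord₁₃ F N θ.toStage13Params P k U ≤ Real.exp (w.ep (gOfRecord₁₃ F N θ.toStage13Params P k) * (Fintype.card (Site (F.P P.K) k) : ℝ)) :=
  fun P hP k hk hS U =>
    uv₁₃_of_upper_of_lowerSmallLocus θ.toStage13Params h.zetaUnity h.zetaAbs hε hε3 hε2 P hk _ _ (hupper P hP k hk hS) (hlowerSmall P hP k hk hS) U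

end Summit.QuantumFields.YangMills.BalabanUVNodes.N13UVRowOfUpperAndSmallLocus

end
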